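/-
Copyright: statement-level skeleton of a published paper (lit-balaban cell, Phase-2 proof seat p26 gen 46). No claims beyond
what the kernel checks below.
-/
import Mathlib
import Literature.MathematicalPhysics.QuantumFieldTheory.Balaban1983to89.B3Ineq213TorusBlocksSigned
import Literature.MathematicalPhysics.QuantumFieldTheory.Balaban1983to89.B3Ineq213VertexBounds

/-!
# B3 — T. Bałaban, *(Higgs)₂,₃ quantum fields in a finite volume. III. Renormalization*, CMP **88** (1983) 411–445
[Balaban1983Higgs3] — p. 426 [PDF 16]: **THE FIRST ESTIMATE (2.13) AT ZERO BACKGROUND, ASSEMBLED** — for a graph of p18's model WITHOUT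
averaging vertices, block-localized anywhere on the torus `T_η`, at print's zero-background data, the pieces of record of this lineage put
together: the line hypotheses of FILE 14 ∕ 19 DISCHARGED from the tree's (2.10) (FILE 19 §6 scalar lines, every differentiation pattern;
FILE 19 §7 vector lines), p19's vertex hypothesis `u_le` DISCHARGED from sup-norm data bounds (FILE 20), p19's kernel family `K_l(t)` TAKEN TO
BE print's torus shape itself, and FILE 19 §1's `abs_graphAmp_le_ineq213_signed_torus` (∘ p19's PROVED `Amp.abs_E_le`) applied — what stays
a hypothesis is exactly what print estimates by OTHER displayed inequalities: the external-field contractions (*"estimated further by the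
Hölder norms"*), the output-pair kernels ((1.18)) and the data sup norms (FILE 21 of the Feynman-rule evaluator lineage).

statement-level skeleton of published theorems with citation tags; proofs where landed; nothing here is a claim about
the Yang–Mills mass gap

PDF held: `paper:balaban1983-higgs-2-3-quantum-fields-finite-volume` (journal page = PDF page + 410); p. 426 [PDF 16] read by this seat
on the text layer `~/.lit/texts/paper-balaban1983-higgs-2-3-quantum-fields-finite-volume/p0016.txt` (2026-08-25).

CITATION HEADER (lean-in-tree rule).  lit-balaban TYPED SKELETON (HOME `run/shared/lean/pub/lit-balaban/`), PHASE 2, seat p26 gen 46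
(unit `lit-balaban-p26`; free-target protocol G.5-34(d), own lane).  ROWS **B3.Eq2.13-2.14** ((2.13) p. 426; head `proved` by p19's
`B3Ineq213Proof`), **B3.Eq2.10** (head `proved`), **B3.Prop1**, **B3.Def@420** of `HOME/lit-balaban-r15/ROWS-B3.md` (fold owner r15;
this file is an OPTIONAL located member, cells only, zero head weight).  CONSUMES BY NAME, nothing re-declared: FILE 19
`B3Ineq213TorusBlocksSigned`: `abs_graphAmp_le_ineq213_signed_torus`, `isDiffLeg`, `hKs_scalarLine_zero_free`,
`hKv_vectorLine_zero_free_bondLegs`; FILE 20 `B3Ineq213VertexBounds`: `DataBounds`, `vConst`, `extraEta`, `u_le_of_dataBounds`,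
`extraEta_kind_nonneg`, `nPhi_nonneg`, `NE_nonneg`; FILE 18 `B3Ineq213TorusBlocks`: `torusTreeLen`, `relBox`, `baseBlock`; FILE 14:
`sigSK`, `sigVK`, `sigOK`, `Lab`, `UOf`; FILE 12: `Lines`, `lineSrc`, `lineTgt`, `modelOfGraph`, `extAt`, `uOfKind`; FILE 2: `graphAmp`,
`Model`, `Loc`, `OutPairing`, `SLine`, `VLine`, `ExtSLeg`, `ExtVLeg`, `sPairing`, `vPairing`; FILE 16 `B3Ineq210ZeroHiggsTorus.gpieceH`; p14's
`B1Eq211ZeroFieldTorus.Shape`; gen-2's `B3Ineq215.Model.{W, Mon}`; p19's `B3Ineq213.LinesConnect`; r15's `B3Prop1.VertexKind`.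

THE PRINTED TEXT (p. 426 [PDF 16], the sentences as printed; re-read on the text layer 2026-08-25, v1.2).  *"In the next step we make a
first estimate of the expression. We estimate it taking absolute values of all factors. The external fields are estimated further by the
Hölder norms and for the operators δG_k and (1.16) we apply the inequality (2.5). For the propagators G_{(j)} we apply the inequality"*
[(2.10)] *"and if the propagator is differentiated, then for each differentiation, there is an additional factor (L^jη)^{−1} on the right
side."* … *"Finally in vertices we apply the inequalities |q| ≦ 1, |R_{n̄+1}(·)| ≦ 1. In the obtained expression we make some partial
summations."*  The lines carry the pieces of the decomposition (2.6), p. 424 [PDF 14]: *"replacing in each line l of the graph G′ the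
corresponding propagator by a propagator G_{(j_l)}, 0 ≦ j_l ≦ k − 1"* (this file's `KsFree` ∕ `KvFree` at the scale index `j_l`).  (v1.0 ∕ v1.1
of this header paraphrased these sentences inside quotation marks — referee note N-ref1-g127-1; corrected here, statements unaffected.)

WHY THIS FILE ∕ READING (declared).  FILE 19 §1 states (2.13) for the signed label form of FILE 2's expression with FIVE families of
hypotheses: the contracted line kernels (`hKs`, `hKv`, `hKo`) dominated by a kernel family `K_l(t)` of p19's torus shape (`hKT`), the external
contractions (`hΦ`, `hA`, `hΨ`), the vertex bound (`u_le`) and p19's side conditions.  At print's ZERO-BACKGROUND data (`B̃ = 0`, free pieces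
`G^η_{(j)}(T_η, 0)` on the lines — FILE 16's `gpieceH_j`, the kernels `KsFree` ∕ `KvFree` below) and for graphs whose vertices are NOT the
averaging vertices (1.14), (1.15) (so that no A′-leg needs (2.12)), FILE 19 §6 ∕ §7 and FILE 20 discharge `hKs`, `hKv`, `u_le` and the side
conditions; choosing `K_l(t; x, x′) := C_l (L^tη)^{a_l} exp[−2δ₀(L^tη)^{−1}·η|x − x′|_T]` (print's shape ITSELF, `torusKer`) makes `hKT` an
identity.  The result: **`abs_graphAmp_le_ineq213_zero`** — constants `δ₁, C₀ > 0` depending on `d, L, a, m²` (scalar and vector) only,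
such that for every torus of p14's sub-family, every step `1 ≤ k ≤ K` with `L^kε ≤ 1`, every zero-background model datum, every such graph
with data sup norms `B_v`, every `0 < δ₀ ≤ δ₁`, every output-pair kernel dominated in the torus shape with rate `δ₀`, every scale assignment
`j ∈ Mon` and every admissible block configuration: `|graphAmp| ≤ (Π_l C_l)·|e|^{d_v(G)}|λ|^{d_s(G)}·e^{−δ₀ d_T({B^k(y_v)})}·Π_v(N²vConst_v)·
Π_v N^ext_v · W(j)` with print's line dimensions `a_l = 2 − d − n_l` (scalar, `n_l` differentiated legs), `2 − d` (vector), and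
`C_l = C₀(L^kε)^{−n_l}` ∕ `C₀` ∕ the supplied output constants.

WHAT IS TYPED ∕ PROVED (definitions with bodies + theorems; no `Prop` fact, no `sorry`; standard axioms).  §1 `torusKer` (print's shape as
a kernel family), `torusKer_nonneg`, `torusKer_weaken` (larger constant, smaller rate), `nDiff`, `lineDim`, `lineConst` (+ `lineConst_nonneg`),
`KsFree`, `KvFree`; §2 **`abs_graphAmp_le_ineq213_zero`** (one scale assignment `j ∈ J(l̃)`, as p19's `abs_E_le`) and
**`abs_sum_graphAmp_le_ineq213_zero`** (the displayed form, summed over `j ∈ J(l̃)` on both sides, as p19's `ineq213_sum`); §3 (v1.1)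
**`abs_sum_graphAmp_le_prop21_zero`** (× gen-2's PROVED (2.15) `ineq215_of_pos` under the printed positive-degree hypothesis: Proposition
2.1's `k`-uniform bound at zero background, constant `const215` of the generalized graph).
HONEST SCOPE.  (a) ZERO BACKGROUND ONLY (`B̃ = 0`; the regular-background feed of FILE 19 §3 ∕ §5 is the successor menu (R)); tori of p14's
sub-family (`Shape`), `L` odd `> 1`, `1 ≤ k ≤ K`, `L^kε ≤ 1`; graphs with `isAveragingVertex (kind v) = false` at every vertex and `n̄ ≥ 1`.
(b) STILL HYPOTHESES, as in print: the external contractions `hΦ`, `hA`, `hΨ` with their per-leg norms (print: Hölder norms, (2.11)-type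
facts for `h`), the output-pair kernels `hKo` ((1.18), row B3.Eq1.18 — supplied in the torus shape with the consumer's constants and the
common rate `δ₀ ≤ δ₁`), the data sup norms `DataBounds` (FILE 20), the block configuration (FILE 18: all blocks within torus distance `D` of
one block, `2D < L^{K−k}ML′_μ`) and connectedness.  (c) The kernels put on the lines are the free pieces `gpieceH_j ⊗ 1_N` (scalar) and
`[μ = μ′]·gpieceH_j(b₋, b′₋)` (vector) with the scale index `j_l` of the assignment — print's *"propagator G_{(j_l)}, 0 ≦ j_l ≦ k − 1"*
(p. 424); the model's normalization `(L^kε)²` of FILE 16's reading (c) is NOT included (it rescales `C₀`).  (d) `eRun = |e|`, `lamRun = |λ|` bare (FILE 20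
(b)); the per-vertex O(1) sits in `N²·vConst_v`.  (e) Nothing new is proved about (2.10), (2.13) or the vertices: this file is the
composition of FILEs 16–20 with p19.  (f) CONSTANTS: `δ₁`, `C₀` depend on `d`, `L`, `a_S`, `m²_S`, `a_V`, `m²_V` ONLY (they are the
min ∕ max of the (2.10) constants of FILE 16's `gpieceH_bounds_model` ∕ `gpieceH_mixed_bound_model` over the mass window) — independent of
`ε`, `k`, `K`, the volume (`M`, `L′_μ`), `N`, the graph, the scale assignment and the data; the displayed prefactor carries in addition
`Π_l C_l` (factors `(L^kε)^{−n_l}` and the supplied output constants) and `Π_v N²vConst_v` (print's O(1) *"depending on n̄ only"* times the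
data norms).  Unit `lit-balaban-p26` gen 46 (literature-prover-lit-balaban-p26-g46-0), HOME
`run/shared/lean/pub/lit-balaban/`, 2026-08-25.  v1.2 (gen 47, literature-prover-lit-balaban-p26-g47-0, 2026-08-25): DOC-ONLY — the p. 426
quote block of this header replaced by the printed sentences (N-ref1-g127-1) and the display of (2.13) re-labelled in the docstring of
`abs_sum_graphAmp_le_ineq213_zero` (D-g110-1); declarations, statements and proofs byte-identical to v1.1.
-/

open Finset
open scoped BigOperators

namespace Literature.MathematicalPhysics.QuantumFieldTheory.Balaban1983to89.B3Ineq213ZeroBackground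

open Literature.MathematicalPhysics.QuantumFieldTheory.Balaban1983to89.B3Cor23Concrete (Graph)
open Literature.MathematicalPhysics.QuantumFieldTheory.Balaban1983to89.B3GraphAmplitude
open Literature.MathematicalPhysics.QuantumFieldTheory.Balaban1983to89.B3GraphAmplitudeRules
open Literature.MathematicalPhysics.QuantumFieldTheory.Balaban1983to89.B3GraphAmplitudePositionForm
open Literature.MathematicalPhysics.QuantumFieldTheory.Balaban1983to89.B3GraphAmplitudeSignedPositionForm
open Literature.MathematicalPhysics.QuantumFieldTheory.Balaban1983to89.B3Ineq213TorusBlocks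
open Literature.MathematicalPhysics.QuantumFieldTheory.Balaban1983to89.B3Ineq213TorusBlocksSigned
open Literature.MathematicalPhysics.QuantumFieldTheory.Balaban1983to89.B3Ineq213VertexBounds
open Literature.MathematicalPhysics.QuantumFieldTheory.Balaban1983to89.B3Ineq213
open Literature.MathematicalPhysics.QuantumFieldTheory.Balaban1983to89.B3Prop1 (VertexKind)
open Literature.MathematicalPhysics.QuantumFieldTheory.Balaban1983to89.HiggsAveraging (blockK)
open Literature.MathematicalPhysics.QuantumFieldTheory.Balaban1983to89.B1Eq211ZeroFieldTorus (Shape)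
open Literature.MathematicalPhysics.QuantumFieldTheory.Balaban1983to89.B3Ineq210ZeroHiggsTorus (gpieceH)

noncomputable section

/-! ## §1 Print's torus shape as p19's kernel family; the line constants and dimensions; the free kernels -/

section Shape

variable {P : HiggsLattice.Params} {N k nbar : ℕ}

/-- **PRINT'S LINE BOUND SHAPE AS A KERNEL FAMILY**: `K(t; x, x′) := C·(L^tη)^a·exp[−(2δ₀∕(L^tη))·η|x − x′|_T]`, `η = L^{−k}` — the right
side of (2.10) (with `δ₁ = 2δ₀`) in the torus distance, at scale index `t`; taken AS p19's `K_l(t)` it makes the hypothesis `hKT` of FILE 18 ∕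
19 an identity. [cite: Balaban1983Higgs3, (2.10) p.426] [cite: Balaban1982Higgs1, (1.3) p.604] -/
def torusKer (L k : ℕ) (δ₀ C a : ℝ) (t : ℕ) (x x' : HiggsLattice.Site P 0) : ℝ :=
  C * ((L : ℝ) ^ t * ((L : ℝ) ^ k)⁻¹) ^ a *
    Real.exp (-(2 * δ₀ / ((L : ℝ) ^ t * ((L : ℝ) ^ k)⁻¹) * (((L : ℝ) ^ k)⁻¹ * (HiggsLattice.Site.tdist x x' : ℝ))))

/-- The shape is `≥ 0` for `C ≥ 0`, `L > 0`. [cite: Balaban1983Higgs3, (2.10) p.426] -/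
theorem torusKer_nonneg {L : ℕ} (hL : 0 < L) (k : ℕ) (δ₀ : ℝ) {C : ℝ} (hC : 0 ≤ C) (a : ℝ) (t : ℕ) (x x' : HiggsLattice.Site P 0) :
    0 ≤ torusKer L k δ₀ C a t x x' := by
  unfold torusKer
  have hLr : (0 : ℝ) < (L : ℝ) := by exact_mod_cast hL
  have hs : 0 < (L : ℝ) ^ t * ((L : ℝ) ^ k)⁻¹ := by positivity
  exact mul_nonneg (mul_nonneg hC (Real.rpow_nonneg hs.le _)) (Real.exp_pos _).le

/-- **Weakening the shape**: a larger constant and a smaller decay rate dominate (`0 ≤ C ≤ C′`, `δ′ ≤ δ`). [cite: Balaban1983Higgs3, (2.10) p.426] -/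
theorem torusKer_weaken {L : ℕ} (hL : 0 < L) (k : ℕ) {δ δ' C C' : ℝ} (hC : 0 ≤ C) (hCC : C ≤ C') (hδ : δ' ≤ δ) (a : ℝ) (t : ℕ)
    (x x' : HiggsLattice.Site P 0) : torusKer L k δ C a t x x' ≤ torusKer L k δ' C' a t x x' := by
  unfold torusKer
  have hLr : (0 : ℝ) < (L : ℝ) := by exact_mod_cast hL
  have hs : 0 < (L : ℝ) ^ t * ((L : ℝ) ^ k)⁻¹ := by positivity
  have hD : 0 ≤ ((L : ℝ) ^ k)⁻¹ * (HiggsLattice.Site.tdist x x' : ℝ) := by positivity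
  have hsa : 0 ≤ ((L : ℝ) ^ t * ((L : ℝ) ^ k)⁻¹) ^ a := Real.rpow_nonneg hs.le _
  have hexp : Real.exp (-(2 * δ / ((L : ℝ) ^ t * ((L : ℝ) ^ k)⁻¹) * (((L : ℝ) ^ k)⁻¹ * (HiggsLattice.Site.tdist x x' : ℝ)))) ≤
      Real.exp (-(2 * δ' / ((L : ℝ) ^ t * ((L : ℝ) ^ k)⁻¹) * (((L : ℝ) ^ k)⁻¹ * (HiggsLattice.Site.tdist x x' : ℝ)))) := by
    apply Real.exp_le_exp.2
    have h1 : 2 * δ' / ((L : ℝ) ^ t * ((L : ℝ) ^ k)⁻¹) ≤ 2 * δ / ((L : ℝ) ^ t * ((L : ℝ) ^ k)⁻¹) :=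
      div_le_div_of_nonneg_right (by linarith) hs.le
    have h2 := mul_le_mul_of_nonneg_right h1 hD
    linarith
  exact mul_le_mul (mul_le_mul_of_nonneg_right hCC hsa) hexp (Real.exp_pos _).le (mul_nonneg (hC.trans hCC) hsa)

variable [DecidableEq (HiggsLattice.PBond P 0)]

/-- **The number of differentiated legs of a line**: for a scalar line the number (0, 1 or 2) of its two `φ′`-legs that are the `∂^η φ′`
legs of (1.8), (1.9) (FILE 19's `isDiffLeg`) — print: *"For each differentiation, there is an additional factor (L^jη)^{−1}"*; vector lines
and output pairs carry none. [cite: Balaban1983Higgs3, (2.10) p.426] [cite: Balaban1983Higgs3, (2.11) p.426] -/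
def nDiff (G : Graph nbar) (Po : OutPairing G) : Lines G Po → ℕ
  | Sum.inl l => (isDiffLeg (G.kind l.1.1) l.1.2).toNat +
      (isDiffLeg (G.kind ((sPairing G).mate l.1).1) ((sPairing G).mate l.1).2).toNat
  | Sum.inr _ => 0

/-- **Print's line dimensions `a_l`** ((2.14): the total dimension of the line's two legs and differentiations): `2 − d − n_l` for a scalar
line with `n_l` differentiated legs ((2.10) with (2.11)-type factors), `2 − d` for a vector line ((2.10)), the supplied `a_o(l)` for an
output pair ((1.18)). [cite: Balaban1983Higgs3, (2.14) p.427] [cite: Balaban1983Higgs3, (2.10) p.426] -/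
def lineDim (G : Graph nbar) (Po : OutPairing G) (d : ℕ) (ao : Po.Line oRank → ℝ) : Lines G Po → ℝ
  | Sum.inl l => (2 : ℝ) - (d : ℝ) - (nDiff G Po (Sum.inl l) : ℝ)
  | Sum.inr (Sum.inl _) => (2 : ℝ) - (d : ℝ)
  | Sum.inr (Sum.inr l) => ao l

/-- **The line constants `C_l`** (print's O(1) of (2.10), uniform in the volume): `C₀·μ^{−n_l}` for a scalar line (`μ = L^kε`, the model's
mesh normalization of the `n_l` difference quotients, FILE 19 §6), `C₀` for a vector line, the supplied `C_o(l)` for an output pair.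
[cite: Balaban1983Higgs3, (2.10) p.426] [cite: Balaban1983Higgs3, (2.13) p.426] -/
def lineConst (G : Graph nbar) (Po : OutPairing G) (μ C₀ : ℝ) (Co : Po.Line oRank → ℝ) : Lines G Po → ℝ
  | Sum.inl l => C₀ * μ⁻¹ ^ nDiff G Po (Sum.inl l)
  | Sum.inr (Sum.inl _) => C₀
  | Sum.inr (Sum.inr l) => Co l

/-- `C_l ≥ 0` for `C₀ ≥ 0`, `μ > 0`, `C_o ≥ 0`. [cite: Balaban1983Higgs3, (2.10) p.426] -/
theorem lineConst_nonneg (G : Graph nbar) (Po : OutPairing G) {μ C₀ : ℝ} (hμ : 0 < μ) (hC₀ : 0 ≤ C₀) {Co : Po.Line oRank → ℝ}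
    (hCo : ∀ l, 0 ≤ Co l) (l : Lines G Po) : 0 ≤ lineConst G Po μ C₀ Co l := by
  rcases l with l | l | l
  · exact mul_nonneg hC₀ (pow_nonneg (inv_nonneg.2 hμ.le) _)
  · exact hC₀
  · exact hCo l

omit [DecidableEq (HiggsLattice.PBond P 0)] in
/-- **The free scalar line kernel at scale index `j`**: `G^η_{(j)}(T_η, 0) ⊗ 1_N` on FILE 2's site–species labels (FILE 16's `gpieceH_j`,
tower mass `m²(L^kε)²`) — print, p. 424: *"replacing in each line l of the graph G′ the corresponding propagator by a propagator G_{(j_l)},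
0 ≦ j_l ≦ k − 1"*, at zero background. [cite: Balaban1983Higgs3, (2.6) p.424] [cite: Balaban1983Higgs3, (2.13) p.426] -/
def KsFree (S : Shape P) (hk : k ≤ P.K) (a m2 : ℝ) (j : ℕ)
    (p p' : HiggsLattice.Site P 0 × Fin N) : ℝ :=
  if p.2 = p'.2 then gpieceH S hk a (m2 * P.mesh k ^ 2) j p.1 p'.1 else 0

omit [DecidableEq (HiggsLattice.PBond P 0)] in
/-- **The free vector line kernel at scale index `j`**: `[μ(b) = μ(b′)]·G^η_{(j)}(T_η, 0; b₋, b′₋)` (the shape of FILE 16's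
`bondEntry_pieceA_zero`, *"the similar equality for the vector field propagator"*). [cite: Balaban1983Higgs3, (2.6) p.424]
[cite: Balaban1983Higgs3, (2.13) p.426] -/
def KvFree (S : Shape P) (hk : k ≤ P.K) (a m2 : ℝ) (j : ℕ) (b b' : HiggsLattice.PBond P 0) : ℝ :=
  if b.dir = b'.dir then gpieceH S hk a (m2 * P.mesh k ^ 2) j b.src b'.src else 0

end Shape

/-! ## §2 (2.13) at zero background, assembled -/

section Assembled

/-- **THE FIRST ESTIMATE (2.13) AT ZERO BACKGROUND FOR A BLOCK-LOCALIZED GRAPH WITHOUT AVERAGING VERTICES, ANYWHERE ON `T_η`** — the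
composition of FILE 19 §1 (`abs_graphAmp_le_ineq213_signed_torus`, itself ∘ p19's PROVED `Amp.abs_E_le`) with the DISCHARGED hypotheses:
scalar lines by FILE 19 §6 (`hKs_scalarLine_zero_free`, every differentiation pattern), vector lines by FILE 19 §7
(`hKv_vectorLine_zero_free_bondLegs`), the vertex bound by FILE 20 (`u_le_of_dataBounds`), p19's side conditions by FILE 20
(`extraEta_kind_nonneg`, `nPhi_nonneg`, `NE_nonneg`) and `lineConst_nonneg`, and the kernel-family hypothesis `hKT` by the choice
`K_l(t) := torusKer` (print's shape itself).  For `d ≥ 1`, odd `L > 1`, `a_S, a_V > 0`, `m²_S, m²_V ≥ 0` there are `δ₁, C₀ > 0` such that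
for every torus of p14's sub-family, `1 ≤ k ≤ K` with `L^kε ≤ 1`, every zero-background datum, every graph with non-averaging vertices and
`n̄ ≥ 1`, data sup norms `B_v`, every `0 < δ₀ ≤ δ₁`, output-pair kernels dominated in the torus shape with rate `δ₀`, every `j ∈ Mon` and
every admissible block configuration:
`|graphAmp| ≤ (Π_l C_l)·(|e|^{d_v(G)}|λ|^{d_s(G)}·e^{−δ₀·d_T({B^k(y_v)})}·Π_v(N²vConst_v)·Π_v N^ext_v)·W_{0,k}(j)`.
[cite: Balaban1983Higgs3, (2.13) p.426] [cite: Balaban1983Higgs3, (2.10) p.426] [cite: Balaban1983Higgs3, (2.14) p.427]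
[cite: Balaban1983Higgs3, p.420] -/
theorem abs_graphAmp_le_ineq213_zero {nbar : ℕ} (d L : ℕ) (hd : 1 ≤ d) (hL : Odd L ∧ 1 < L)
    {aS : ℝ} (haS : 0 < aS) {mS : ℝ} (hmS : 0 ≤ mS) {aV : ℝ} (haV : 0 < aV) {mV : ℝ} (hmV : 0 ≤ mV) :
    ∃ δ₁ C₀ : ℝ, 0 < δ₁ ∧ 0 < C₀ ∧
    ∀ (P : HiggsLattice.Params) [DecidableEq (HiggsLattice.PBond P 0)] (S : Shape P), P.d = d → P.L = L →
    ∀ (k : ℕ) (hk : k ≤ P.K), 1 ≤ k → P.mesh k ≤ 1 → ∀ (hL2 : 2 ≤ P.L) (N : ℕ) (Mh : Model P N k), Mh.B = 0 →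
    ∀ (G : Graph nbar), 1 ≤ nbar → (∀ v, (G.kind v).isAveragingVertex = false) →
    ∀ (dm2 : Fin G.nV → HiggsLattice.Site P 0 → ℝ) (loc : Fin G.nV → Loc P k) (B : ∀ v, DataBounds Mh (dm2 v) (loc v))
      (Po : OutPairing G) (Ko : Po.Line oRank → HiggsLattice.Site P k × Fin N → HiggsLattice.Site P k × Fin N → ℝ)
      (Φ : (ExtSLeg G → HiggsLattice.Site P 0 × Fin N) → ℝ) (A : (ExtVLeg G → HiggsLattice.PBond P 0) → ℝ)
      (Ψ : (Po.Ext → HiggsLattice.Site P k × Fin N) → ℝ)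
      {m : ℕ} (eL : Fin m ≃ Lines G Po) (δ₀ : ℝ) (hδ : 0 < δ₀), δ₀ ≤ δ₁ →
    ∀ (ao : Po.Line oRank → ℝ) (Co : Po.Line oRank → ℝ), (∀ l, 0 ≤ Co l) →
    ∀ {j : Fin m → ℕ}, j ∈ B3Ineq215.Model.Mon m k →
    (∀ (l : Po.Line oRank) (ξ₁ ξ₂ : Lab P N),
      |∑ r, ∑ r', sigOK k (G.kind l.1.1) l.1.2 ξ₁ r * sigOK k (G.kind (Po.mate l.1).1) (Po.mate l.1).2 ξ₂ r' * Ko l r r'| ≤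
        torusKer P.L k δ₀ (Co l) (ao l) (j (eL.symm (Sum.inr (Sum.inr l)))) ξ₁.pos ξ₂.pos) →
    ∀ (nS : ExtSLeg G → HiggsLattice.Site P 0 → ℝ), (∀ e x, 0 ≤ nS e x) →
    (∀ ξ : Fin G.nV → Lab P N,
      |∑ γ : ExtSLeg G → HiggsLattice.Site P 0 × Fin N, (∏ e : ExtSLeg G, sigSK Mh (G.kind e.1.1) e.1.2 (ξ e.1.1) (γ e)) * Φ γ| ≤
        ∏ e : ExtSLeg G, nS e (ξ e.1.1).pos) →
    ∀ (nV : ExtVLeg G → HiggsLattice.Site P 0 → ℝ), (∀ e x, 0 ≤ nV e x) →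
    (∀ ξ : Fin G.nV → Lab P N,
      |∑ ζ : ExtVLeg G → HiggsLattice.PBond P 0, (∏ e : ExtVLeg G, sigVK Mh (G.kind e.1.1) e.1.2 (ξ e.1.1) (ζ e)) * A ζ| ≤
        ∏ e : ExtVLeg G, nV e (ξ e.1.1).pos) →
    ∀ (nO : Po.Ext → HiggsLattice.Site P 0 → ℝ), (∀ e x, 0 ≤ nO e x) →
    (∀ ξ : Fin G.nV → Lab P N,
      |∑ ο : Po.Ext → HiggsLattice.Site P k × Fin N, (∏ e : Po.Ext, sigOK k (G.kind e.1.1) e.1.2 (ξ e.1.1) (ο e)) * Ψ ο| ≤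
        ∏ e : Po.Ext, nO e (ξ e.1.1).pos) →
    ∀ (NE : Fin G.nV → ℝ), (∀ v x, |extAt Po nS nV nO v x| ≤ NE v) →
    ∀ (y : Fin G.nV → HiggsLattice.Site P k),
      (∀ v x, x ∉ blockK k (y v) → uOfKind Mh (dm2 v) (loc v) (G.kind v) x = 0) →
    ∀ (p : HiggsLattice.Site P k) (D : ℕ), (∀ v, HiggsLattice.Site.tdist (y v) p ≤ D) → (∀ μ, 2 * D < P.halfPerDir k μ) →
    LinesConnect (fun i => lineSrc Po (eL i)) (fun i => lineTgt Po (eL i)) →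
    |graphAmp G Mh dm2 loc Po (fun l => KsFree S hk aS mS (j (eL.symm (Sum.inl l))))
        (fun l => KvFree S hk aV mV (j (eL.symm (Sum.inr (Sum.inl l))))) Ko Φ A Ψ| ≤
      (∏ i, lineConst G Po (P.mesh k) C₀ Co (eL i)) *
        (|Mh.C.e| ^ (∑ v, (G.kind v).dv) * |Mh.lamRun| ^ (∑ v, (G.kind v).ds) * Real.exp (-(δ₀ * torusTreeLen k y)) *
          (∏ v, (N : ℝ) ^ 2 * vConst (B v) (G.kind v)) * ∏ v, NE v) *
        (modelOfGraph G Po eL (fun v => ((extraEta (G.kind v) : ℤ) : ℝ)) (fun i => lineDim G Po P.d ao (eL i)) P.d P.L δ₀ P.hd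
          hL2 hδ).W 0 k j (fun v => relBox (baseBlock p D) (y v)) := by
  obtain ⟨δs, Cs, hδs, hCs, hS⟩ := hKs_scalarLine_zero_free d L hd hL haS hmS
  obtain ⟨δv, Cv, hδv, hCv, hV⟩ := hKv_vectorLine_zero_free_bondLegs d L hd hL haV hmV
  refine ⟨min δs δv, max Cs Cv, lt_min hδs hδv, lt_max_of_lt_left hCs, ?_⟩
  intro P _ S hPd hPL k hk hk1 hmesh hL2 N Mh hB G hn hG dm2 loc B Po Ko Φ A Ψ m eL δ₀ hδ hδ₁ ao Co hCo j hj hKo nS hnS0 hΦ nV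
    hnV0 hA nO hnO0 hΨ NE hNE y hloc p D hy hD conn
  have hLpos : 0 < P.L := P.hL
  have hmk : 0 < P.mesh k := P.mesh_pos k
  have hC₀ : 0 ≤ max Cs Cv := hCs.le.trans (le_max_left _ _)
  have hC0 : ∀ i, 0 ≤ lineConst G Po (P.mesh k) (max Cs Cv) Co (eL i) := fun i =>
    lineConst_nonneg G Po hmk hC₀ hCo (eL i)
  refine abs_graphAmp_le_ineq213_signed_torus hk hL2 G Mh dm2 loc Po
    (fun l => KsFree S hk aS mS (j (eL.symm (Sum.inl l)))) (fun l => KvFree S hk aV mV (j (eL.symm (Sum.inr (Sum.inl l))))) Ko Φ A Ψ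
    eL (fun v => ((extraEta (G.kind v) : ℤ) : ℝ)) (fun i => lineDim G Po P.d ao (eL i)) δ₀ hδ hj
    (fun i t x x' => torusKer P.L k δ₀ (lineConst G Po (P.mesh k) (max Cs Cv) Co (eL i)) (lineDim G Po P.d ao (eL i)) t x x')
    (fun i t x x' => torusKer_nonneg hLpos k δ₀ (hC0 i) _ t x x') ?_ ?_ ?_ nS hnS0 hΦ nV hnV0 hA nO hnO0 hΨ y hloc p D hy hD
    (fun i => lineConst G Po (P.mesh k) (max Cs Cv) Co (eL i)) |Mh.C.e| |Mh.lamRun| (fun v => (G.kind v).dv)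
    (fun v => (G.kind v).ds) (fun v => (N : ℝ) ^ 2 * vConst (B v) (G.kind v)) NE hC0 (abs_nonneg _) (abs_nonneg _)
    (nPhi_nonneg G Mh dm2 loc B) (NE_nonneg hNE) (extraEta_kind_nonneg G hn) conn
    (u_le_of_dataBounds G Mh dm2 loc B hmesh Po nS nV nO NE hNE) ?_
  · -- scalar lines: FILE 19 §6, weakened to the common constants
    intro l ξ₁ ξ₂
    have h := hS P S hPd hPL k hk hk1 hmesh N Mh hB (j (eL.symm (Sum.inl l))) (G.kind l.1.1)
      (G.kind ((sPairing G).mate l.1).1) l.1.2 ((sPairing G).mate l.1).2 ξ₁ ξ₂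
    rw [Equiv.apply_symm_apply]
    refine h.trans ?_
    change torusKer P.L k δs (Cs * (P.mesh k)⁻¹ ^ nDiff G Po (Sum.inl l)) (lineDim G Po P.d ao (Sum.inl l))
      (j (eL.symm (Sum.inl l))) ξ₁.pos ξ₂.pos ≤ _
    exact torusKer_weaken hLpos k (by positivity) (mul_le_mul_of_nonneg_right (le_max_left _ _) (by positivity))
      (hδ₁.trans (min_le_left _ _)) _ _ _ _
  · -- vector lines (both endpoints bond vertices): FILE 19 §7, weakened
    intro l ξ₁ ξ₂
    have h := hV P S hPd hPL k hk hk1 hmesh N Mh (j (eL.symm (Sum.inr (Sum.inl l)))) (G.kind l.1.1)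
      (G.kind ((vPairing G).mate l.1).1) (hG _) (hG _) l.1.2 ((vPairing G).mate l.1).2 ξ₁ ξ₂
    rw [Equiv.apply_symm_apply]
    refine h.trans ?_
    change torusKer P.L k δv Cv (lineDim G Po P.d ao (Sum.inr (Sum.inl l))) (j (eL.symm (Sum.inr (Sum.inl l)))) ξ₁.pos ξ₂.pos ≤ _
    exact torusKer_weaken hLpos k hCv.le (le_max_right _ _) (hδ₁.trans (min_le_right _ _)) _ _ _ _
  · -- output pairs: the hypothesis, read through the enumeration
    intro l ξ₁ ξ₂
    rw [Equiv.apply_symm_apply]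
    exact hKo l ξ₁ ξ₂
  · -- p19's `K_le` for the torus shape itself: an identity
    intro i t _ x x'
    rw [abs_of_nonneg (torusKer_nonneg hLpos k δ₀ (hC0 i) _ t x x')]
    exact le_of_eq rfl

/-- **THE DISPLAYED FORM OF (2.13): SUMMED OVER THE SCALE ASSIGNMENTS `j ∈ J(l̃)` ON BOTH SIDES** — *"|Σ_{j∈J(l̃)} E(G(j), {□(v)}_{v∈G},
Φ′_ext, A_ext)| ≦ O(1)(e(L^kε))^{d_v(G)}(λ(L^kε))^{d_s(G)} exp[−½δ₁ d({□(v)}_{v∈G})] … Σ_{j∈J(l̃)} Ẽ(G(j), {□(v)}_{v∈G})"* (2.13), where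
`Ẽ(G(j), {□(v)}_{v∈G})` is the sum over the cubes `{Δ(v)}` displayed in (2.14) (here gen-2's `W`, summed over the cubes inside; v1.2: display
re-labelled per referee note D-g110-1 — v1.0 wrote the (2.14)∕(2.15) form `Σ_{{Δ(v)}}` into (2.13)): the term of assignment `j` carries the
free pieces `G^η_{(j_l)}` on its lines (`KsFree`, `KvFree` at `j_l`) and output-pair kernels `Ko j` dominated in the torus shape; the previous
theorem termwise, `|Σ| ≤ Σ|·|`. [cite: Balaban1983Higgs3, (2.13) p.426] [cite: Balaban1983Higgs3, (2.14) p.427] -/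
theorem abs_sum_graphAmp_le_ineq213_zero {nbar : ℕ} (d L : ℕ) (hd : 1 ≤ d) (hL : Odd L ∧ 1 < L)
    {aS : ℝ} (haS : 0 < aS) {mS : ℝ} (hmS : 0 ≤ mS) {aV : ℝ} (haV : 0 < aV) {mV : ℝ} (hmV : 0 ≤ mV) :
    ∃ δ₁ C₀ : ℝ, 0 < δ₁ ∧ 0 < C₀ ∧
    ∀ (P : HiggsLattice.Params) [DecidableEq (HiggsLattice.PBond P 0)] (S : Shape P), P.d = d → P.L = L →
    ∀ (k : ℕ) (hk : k ≤ P.K), 1 ≤ k → P.mesh k ≤ 1 → ∀ (hL2 : 2 ≤ P.L) (N : ℕ) (Mh : Model P N k), Mh.B = 0 →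
    ∀ (G : Graph nbar), 1 ≤ nbar → (∀ v, (G.kind v).isAveragingVertex = false) →
    ∀ (dm2 : Fin G.nV → HiggsLattice.Site P 0 → ℝ) (loc : Fin G.nV → Loc P k) (B : ∀ v, DataBounds Mh (dm2 v) (loc v))
      (Po : OutPairing G) {m : ℕ}
      (Ko : (Fin m → ℕ) → Po.Line oRank → HiggsLattice.Site P k × Fin N → HiggsLattice.Site P k × Fin N → ℝ)
      (Φ : (ExtSLeg G → HiggsLattice.Site P 0 × Fin N) → ℝ) (A : (ExtVLeg G → HiggsLattice.PBond P 0) → ℝ)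
      (Ψ : (Po.Ext → HiggsLattice.Site P k × Fin N) → ℝ)
      (eL : Fin m ≃ Lines G Po) (δ₀ : ℝ) (hδ : 0 < δ₀), δ₀ ≤ δ₁ →
    ∀ (ao : Po.Line oRank → ℝ) (Co : Po.Line oRank → ℝ), (∀ l, 0 ≤ Co l) →
    (∀ j ∈ B3Ineq215.Model.Mon m k, ∀ (l : Po.Line oRank) (ξ₁ ξ₂ : Lab P N),
      |∑ r, ∑ r', sigOK k (G.kind l.1.1) l.1.2 ξ₁ r * sigOK k (G.kind (Po.mate l.1).1) (Po.mate l.1).2 ξ₂ r' * Ko j l r r'| ≤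
        torusKer P.L k δ₀ (Co l) (ao l) (j (eL.symm (Sum.inr (Sum.inr l)))) ξ₁.pos ξ₂.pos) →
    ∀ (nS : ExtSLeg G → HiggsLattice.Site P 0 → ℝ), (∀ e x, 0 ≤ nS e x) →
    (∀ ξ : Fin G.nV → Lab P N,
      |∑ γ : ExtSLeg G → HiggsLattice.Site P 0 × Fin N, (∏ e : ExtSLeg G, sigSK Mh (G.kind e.1.1) e.1.2 (ξ e.1.1) (γ e)) * Φ γ| ≤
        ∏ e : ExtSLeg G, nS e (ξ e.1.1).pos) →
    ∀ (nV : ExtVLeg G → HiggsLattice.Site P 0 → ℝ), (∀ e x, 0 ≤ nV e x) →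
    (∀ ξ : Fin G.nV → Lab P N,
      |∑ ζ : ExtVLeg G → HiggsLattice.PBond P 0, (∏ e : ExtVLeg G, sigVK Mh (G.kind e.1.1) e.1.2 (ξ e.1.1) (ζ e)) * A ζ| ≤
        ∏ e : ExtVLeg G, nV e (ξ e.1.1).pos) →
    ∀ (nO : Po.Ext → HiggsLattice.Site P 0 → ℝ), (∀ e x, 0 ≤ nO e x) →
    (∀ ξ : Fin G.nV → Lab P N,
      |∑ ο : Po.Ext → HiggsLattice.Site P k × Fin N, (∏ e : Po.Ext, sigOK k (G.kind e.1.1) e.1.2 (ξ e.1.1) (ο e)) * Ψ ο| ≤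
        ∏ e : Po.Ext, nO e (ξ e.1.1).pos) →
    ∀ (NE : Fin G.nV → ℝ), (∀ v x, |extAt Po nS nV nO v x| ≤ NE v) →
    ∀ (y : Fin G.nV → HiggsLattice.Site P k),
      (∀ v x, x ∉ blockK k (y v) → uOfKind Mh (dm2 v) (loc v) (G.kind v) x = 0) →
    ∀ (p : HiggsLattice.Site P k) (D : ℕ), (∀ v, HiggsLattice.Site.tdist (y v) p ≤ D) → (∀ μ, 2 * D < P.halfPerDir k μ) →
    LinesConnect (fun i => lineSrc Po (eL i)) (fun i => lineTgt Po (eL i)) →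
    |∑ j ∈ B3Ineq215.Model.Mon m k, graphAmp G Mh dm2 loc Po (fun l => KsFree S hk aS mS (j (eL.symm (Sum.inl l))))
        (fun l => KvFree S hk aV mV (j (eL.symm (Sum.inr (Sum.inl l))))) (Ko j) Φ A Ψ| ≤
      (∏ i, lineConst G Po (P.mesh k) C₀ Co (eL i)) *
        (|Mh.C.e| ^ (∑ v, (G.kind v).dv) * |Mh.lamRun| ^ (∑ v, (G.kind v).ds) * Real.exp (-(δ₀ * torusTreeLen k y)) *
          (∏ v, (N : ℝ) ^ 2 * vConst (B v) (G.kind v)) * ∏ v, NE v) *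
        ∑ j ∈ B3Ineq215.Model.Mon m k,
          (modelOfGraph G Po eL (fun v => ((extraEta (G.kind v) : ℤ) : ℝ)) (fun i => lineDim G Po P.d ao (eL i)) P.d P.L δ₀ P.hd
            hL2 hδ).W 0 k j (fun v => relBox (baseBlock p D) (y v)) := by
  obtain ⟨δ₁, C₀, hδ₁, hC₀, h⟩ := abs_graphAmp_le_ineq213_zero (nbar := nbar) d L hd hL haS hmS haV hmV
  refine ⟨δ₁, C₀, hδ₁, hC₀, ?_⟩
  intro P _ S hPd hPL k hk hk1 hmesh hL2 N Mh hB G hn hG dm2 loc B Po m Ko Φ A Ψ eL δ₀ hδ hδδ ao Co hCo hKo nS hnS0 hΦ nV hnV0 hA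
    nO hnO0 hΨ NE hNE y hloc p D hy hD conn
  rw [Finset.mul_sum]
  refine (Finset.abs_sum_le_sum_abs _ _).trans (Finset.sum_le_sum fun j hj => ?_)
  exact h P S hPd hPL k hk hk1 hmesh hL2 N Mh hB G hn hG dm2 loc B Po (Ko j) Φ A Ψ eL δ₀ hδ hδδ ao Co hCo hj (hKo j hj) nS hnS0
    hΦ nV hnV0 hA nO hnO0 hΨ NE hNE y hloc p D hy hD conn

end Assembled

/-! ## §3 (v1.1) With the tree's (2.15): Proposition 2.1's `k`-uniform bound at zero background -/

section Uniform

/-- **PROPOSITION 2.1'S BOUND AT ZERO BACKGROUND, `k`-UNIFORM** — (2.13) summed over `j ∈ J(l̃)` (§2) times gen-2's PROVED (2.15)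
(`B3Ineq215.Model.ineq215_of_pos`: *"Σ_{j∈J(l̃)} Σ_{{Δ(v)}} Ẽ(G(j), {Δ(v)}) ≦ O(1)"* when the subgraphs `G₁, …, G_m` of the line order have
positive degrees, p. 426–428): under that printed degree hypothesis for the generalized graph of FILE 12 §7 (`modelOfGraph` with the
`η`-powers `extraEta` and the line dimensions `lineDim`), `|Σ_{j∈J(l̃)} graphAmp_j| ≤ (Π_l C_l)·(|e|^{d_v(G)}|λ|^{d_s(G)}·e^{−δ₀ d_T({B^k(y_v)})}·
Π_v(N²vConst_v)·Π_v N^ext_v)·const215` with gen-2's `const215` — a function of the generalized graph (`d`, `L`, `δ₀`, `e_v`, `a_l`, the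
order) alone: independent of `ε`, `k`, `K`, the volume and the cubes (*"O(1) is a constant depending on n̄ only"*).
[cite: Balaban1983Higgs3, (2.13) p.426] [cite: Balaban1983Higgs3, (2.15) p.427] [cite: Balaban1983Higgs3, Proposition 2.1 p.426] -/
theorem abs_sum_graphAmp_le_prop21_zero {nbar : ℕ} (d L : ℕ) (hd : 1 ≤ d) (hL : Odd L ∧ 1 < L)
    {aS : ℝ} (haS : 0 < aS) {mS : ℝ} (hmS : 0 ≤ mS) {aV : ℝ} (haV : 0 < aV) {mV : ℝ} (hmV : 0 ≤ mV) :
    ∃ δ₁ C₀ : ℝ, 0 < δ₁ ∧ 0 < C₀ ∧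
    ∀ (P : HiggsLattice.Params) [DecidableEq (HiggsLattice.PBond P 0)] (S : Shape P), P.d = d → P.L = L →
    ∀ (k : ℕ) (hk : k ≤ P.K), 1 ≤ k → P.mesh k ≤ 1 → ∀ (hL2 : 2 ≤ P.L) (N : ℕ) (Mh : Model P N k), Mh.B = 0 →
    ∀ (G : Graph nbar), 1 ≤ nbar → (∀ v, (G.kind v).isAveragingVertex = false) →
    ∀ (dm2 : Fin G.nV → HiggsLattice.Site P 0 → ℝ) (loc : Fin G.nV → Loc P k) (B : ∀ v, DataBounds Mh (dm2 v) (loc v))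
      (Po : OutPairing G) {m : ℕ}
      (Ko : (Fin m → ℕ) → Po.Line oRank → HiggsLattice.Site P k × Fin N → HiggsLattice.Site P k × Fin N → ℝ)
      (Φ : (ExtSLeg G → HiggsLattice.Site P 0 × Fin N) → ℝ) (A : (ExtVLeg G → HiggsLattice.PBond P 0) → ℝ)
      (Ψ : (Po.Ext → HiggsLattice.Site P k × Fin N) → ℝ)
      (eL : Fin m ≃ Lines G Po) (δ₀ : ℝ) (hδ : 0 < δ₀), δ₀ ≤ δ₁ →
    ∀ (ao : Po.Line oRank → ℝ) (Co : Po.Line oRank → ℝ), (∀ l, 0 ≤ Co l) →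
    (∀ j ∈ B3Ineq215.Model.Mon m k, ∀ (l : Po.Line oRank) (ξ₁ ξ₂ : Lab P N),
      |∑ r, ∑ r', sigOK k (G.kind l.1.1) l.1.2 ξ₁ r * sigOK k (G.kind (Po.mate l.1).1) (Po.mate l.1).2 ξ₂ r' * Ko j l r r'| ≤
        torusKer P.L k δ₀ (Co l) (ao l) (j (eL.symm (Sum.inr (Sum.inr l)))) ξ₁.pos ξ₂.pos) →
    ∀ (nS : ExtSLeg G → HiggsLattice.Site P 0 → ℝ), (∀ e x, 0 ≤ nS e x) →
    (∀ ξ : Fin G.nV → Lab P N,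
      |∑ γ : ExtSLeg G → HiggsLattice.Site P 0 × Fin N, (∏ e : ExtSLeg G, sigSK Mh (G.kind e.1.1) e.1.2 (ξ e.1.1) (γ e)) * Φ γ| ≤
        ∏ e : ExtSLeg G, nS e (ξ e.1.1).pos) →
    ∀ (nV : ExtVLeg G → HiggsLattice.Site P 0 → ℝ), (∀ e x, 0 ≤ nV e x) →
    (∀ ξ : Fin G.nV → Lab P N,
      |∑ ζ : ExtVLeg G → HiggsLattice.PBond P 0, (∏ e : ExtVLeg G, sigVK Mh (G.kind e.1.1) e.1.2 (ξ e.1.1) (ζ e)) * A ζ| ≤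
        ∏ e : ExtVLeg G, nV e (ξ e.1.1).pos) →
    ∀ (nO : Po.Ext → HiggsLattice.Site P 0 → ℝ), (∀ e x, 0 ≤ nO e x) →
    (∀ ξ : Fin G.nV → Lab P N,
      |∑ ο : Po.Ext → HiggsLattice.Site P k × Fin N, (∏ e : Po.Ext, sigOK k (G.kind e.1.1) e.1.2 (ξ e.1.1) (ο e)) * Ψ ο| ≤
        ∏ e : Po.Ext, nO e (ξ e.1.1).pos) →
    ∀ (NE : Fin G.nV → ℝ), (∀ v x, |extAt Po nS nV nO v x| ≤ NE v) →
    ∀ (y : Fin G.nV → HiggsLattice.Site P k),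
      (∀ v x, x ∉ blockK k (y v) → uOfKind Mh (dm2 v) (loc v) (G.kind v) x = 0) →
    ∀ (p : HiggsLattice.Site P k) (D : ℕ), (∀ v, HiggsLattice.Site.tdist (y v) p ≤ D) → (∀ μ, 2 * D < P.halfPerDir k μ) →
    LinesConnect (fun i => lineSrc Po (eL i)) (fun i => lineTgt Po (eL i)) →
    (∀ i, i ≤ m → ∀ b ∈ (modelOfGraph G Po eL (fun v => ((extraEta (G.kind v) : ℤ) : ℝ)) (fun i => lineDim G Po P.d ao (eL i)) P.d P.L δ₀ P.hd hL2 hδ).reps i, (modelOfGraph G Po eL (fun v => ((extraEta (G.kind v) : ℤ) : ℝ)) (fun i => lineDim G Po P.d ao (eL i)) P.d P.L δ₀ P.hd hL2 hδ).Nontriv i b → 0 < (modelOfGraph G Po eL (fun v => ((extraEta (G.kind v) : ℤ) : ℝ)) (fun i => lineDim G Po P.d ao (eL i)) P.d P.L δ₀ P.hd hL2 hδ).D i b) →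
    |∑ j ∈ B3Ineq215.Model.Mon m k, graphAmp G Mh dm2 loc Po (fun l => KsFree S hk aS mS (j (eL.symm (Sum.inl l))))
        (fun l => KvFree S hk aV mV (j (eL.symm (Sum.inr (Sum.inl l))))) (Ko j) Φ A Ψ| ≤
      (∏ i, lineConst G Po (P.mesh k) C₀ Co (eL i)) *
        (|Mh.C.e| ^ (∑ v, (G.kind v).dv) * |Mh.lamRun| ^ (∑ v, (G.kind v).ds) * Real.exp (-(δ₀ * torusTreeLen k y)) *
          (∏ v, (N : ℝ) ^ 2 * vConst (B v) (G.kind v)) * ∏ v, NE v) *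
        (modelOfGraph G Po eL (fun v => ((extraEta (G.kind v) : ℤ) : ℝ)) (fun i => lineDim G Po P.d ao (eL i)) P.d P.L δ₀ P.hd hL2 hδ).const215 := by
  obtain ⟨δ₁, C₀, hδ₁, hC₀, h⟩ := abs_sum_graphAmp_le_ineq213_zero (nbar := nbar) d L hd hL haS hmS haV hmV
  refine ⟨δ₁, C₀, hδ₁, hC₀, ?_⟩
  intro P _ S hPd hPL k hk hk1 hmesh hL2 N Mh hB G hn hG dm2 loc B Po m Ko Φ A Ψ eL δ₀ hδ hδδ ao Co hCo hKo nS hnS0 hΦ nV hnV0 hA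
    nO hnO0 hΨ NE hNE y hloc p D hy hD conn hpos
  refine (h P S hPd hPL k hk hk1 hmesh hL2 N Mh hB G hn hG dm2 loc B Po Ko Φ A Ψ eL δ₀ hδ hδδ ao Co hCo hKo nS hnS0 hΦ nV hnV0 hA
    nO hnO0 hΨ NE hNE y hloc p D hy hD conn).trans ?_
  have hC : 0 ≤ ∏ i, lineConst G Po (P.mesh k) C₀ Co (eL i) :=
    Finset.prod_nonneg fun i _ => lineConst_nonneg G Po (P.mesh_pos k) hC₀.le hCo (eL i)
  have hΦn : 0 ≤ ∏ v, (N : ℝ) ^ 2 * vConst (B v) (G.kind v) := Finset.prod_nonneg fun v _ => nPhi_nonneg G Mh dm2 loc B v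
  have hNEn : 0 ≤ ∏ v, NE v := Finset.prod_nonneg fun v _ => NE_nonneg hNE v
  have hpre : 0 ≤ (∏ i, lineConst G Po (P.mesh k) C₀ Co (eL i)) *
      (|Mh.C.e| ^ (∑ v, (G.kind v).dv) * |Mh.lamRun| ^ (∑ v, (G.kind v).ds) * Real.exp (-(δ₀ * torusTreeLen k y)) *
        (∏ v, (N : ℝ) ^ 2 * vConst (B v) (G.kind v)) * ∏ v, NE v) :=
    mul_nonneg hC (mul_nonneg (mul_nonneg (mul_nonneg (mul_nonneg (pow_nonneg (abs_nonneg _) _) (pow_nonneg (abs_nonneg _) _))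
      (Real.exp_pos _).le) hΦn) hNEn)
  exact mul_le_mul_of_nonneg_left (B3Ineq215.Model.ineq215_of_pos _ hpos k _) hpre

end Uniform

end

end Literature.MathematicalPhysics.QuantumFieldTheory.Balaban1983to89.B3Ineq213ZeroBackground
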